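import Literature.MathematicalPhysics.QuantumLattice.XYOrderGDProofs
import Literature.MathematicalPhysics.QuantumLattice.HeisenbergOrderEvenTorusLROProofs
import HarnessLib

/-!
# Kennedy–Lieb–Shastry / Dyson–Lieb–Simon: Néel order in the ground state — finite-volume architecture

Trunk T-QLATTICE; sibling proof file `HeisenbergOrderNeelProofs.lean` of `HeisenbergOrder.lean`
(named fact `kennedy_lieb_shastry_ground`, item
`provefact-Literature.MathematicalPhysics.QuantumLa-0a1fdca558`).
No statement of `HeisenbergOrder.lean` is changed. This file sets up the finite-volume objects of
Kennedy–Lieb–Shastry, *Existence of Néel order in some spin-½ Heisenberg antiferromagnets*,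
J. Stat. Phys. 53 (1988) 1019–1030 (`KLS1988JSP`), pp. 1021–1022, eqs. (1)–(4), for the
nearest-neighbour Heisenberg antiferromagnet `H = Σ_{⟨xy⟩} 𝐒_x · 𝐒_y` on the even tori
`(ℤ/2kℤ)^d` and its tracial ground state `ω` (`Matrix.groundStateFunctional`), and PROVES:

* the reduction to `J = 1` (`ω_{JH} = ω_H` for `J > 0`: `Matrix.groundStateFunctional_smul_of_pos`);
* (I) isotropy `⟨S¹_xS¹_y⟩ = ⟨S²_xS²_y⟩ = ⟨S³_xS³_y⟩` (the quarter turn about the `3`-axis and the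
  quarter turn about the `2`-axis are product unitaries commuting with `H`);
* (T) the a priori bound `|⟨Sᵅ_xSᵅ_y⟩| ≤ S²`;
* (C) the sum rule `|Λ|⁻¹ Σ_q ĝ_q (d⁻¹ Σᵢ cos qᵢ) = ε` (KLS eq. (3) in finite volume; `ε < 0` is the
  nearest-neighbour correlation per spin component, KLS's `-e₀/(3d)`), by the character
  orthogonality already proved for the XY model (`sum_structureFactor_mul_cos`);
* (N) the Néel variational bound `-ε ≥ S²/3` (KLS p. 1022: "taking the Néel state as a
  variational state shows that `-e₀` is less than `-3/4`", here `e₀ ≥ d S²` for all `S`, `d`);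
* the identification of the Néel order parameter of the statement (unfolded by the tree's
  `hasStaggeredEvenTorusLRO_iff_holds`, `HeisenbergOrderEvenTorusLROProofs.lean`) with
  `3 |Λ|⁻¹ ĝ_Q`, `Q = (π, …, π)`;
* KLS's inequality (4) in finite volume: from the `T = 0` infrared bound (A) at `q ≠ Q`,
  `-ε ≤ |Λ|⁻¹ ĝ_Q + (-ε/2)^{1/2} R_L(d)`, where `R_L(d)` is the punctured Riemann sum
  `klsRiemannSum d L` of the SAME lattice integrand as in the XY model (after `q = p + Q`,
  `(E_q/E_{q-Q})^{1/2} d⁻¹(-Σᵢ cos qᵢ)₊ = klsIntegrand d p`);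
* (the sibling `HeisenbergOrderNeelAssembly.lean` then proves KLS's inequality (4) and the
  assembly `kennedy_lieb_shastry_ground_of_infraredBound`: the infrared bound (A) — to be obtained
  from ground-state Gaussian domination, KLS eqs. (12)–(19), as for the XY model — and an eventual
  bound `R_L(3) ≤ ρ < 1/√6` imply `kennedy_lieb_shastry_ground`; for spin `S ≥ 1` the tree's bound
  `limsup_L R_L(d) ≤ 3√2/(2π) < 2/√6` (`klsRiemannSum_eventually_le`) already suffices).

## References

* [KLS1988JSP] T. Kennedy, E. H. Lieb, B. S. Shastry, J. Stat. Phys. 53 (1988) 1019–1030,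
  pp. 1021–1022, eqs. (1)–(4); pp. 1026–1027, eqs. (12)–(19) (read in: E. H. Lieb, *Statistical
  Mechanics (Selecta)*, Springer 2004, paper IV.7).
* [DysonLiebSimon1978] F. J. Dyson, E. H. Lieb, B. Simon, J. Stat. Phys. 18 (1978) 335–383, §1 and
  App. C (the Néel state as a trial state).
* H. Tasaki, *Physics and Mathematics of Quantum Many-Body Systems* (2020), §2.1–2.5, §4.4.

## Design choices

* All objects mirror `XYOrderProofs.lean`: `heisGroundCorr α L n x y = Re ω(Sᵅ_xSᵅ_y)` for
  `H₁ = heisenbergTorus d L n 1`, the structure factor `heisStructureFactor` with the phase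
  `torusPhase` on canonical representatives, the site- and direction-averaged bond correlation
  `heisBondCorr`; junk value `0` at `L = 0`.
* The antiferromagnetic momentum `Q` is the dual-torus point `neelIndex L = (L/2, …, L/2)`; on the
  even torus `cos(Q·z) = (-1)^{Σ zᵢ}` on canonical representatives, which is how the staggered sums
  of `HasStaggeredEvenTorusLRO` are identified with `ĝ_Q`.
* No new named fact is introduced: the infrared bound (A) and the numerical bound on `R_L(3)` enter
  the assembly as explicit hypotheses, to be discharged by sibling proof files.
-/

noncomputable section

open Filter Topology Matrix Finset
open Literature.MathematicalPhysics.QuantumLattice Literature.MathematicalPhysics.QuantumLattice.SpinOperators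
  Literature.Probability.LatticeModels

/-! ### Scaling the Hamiltonian by a positive constant does not change the ground state -/

namespace Matrix

variable {m : Type*} [Fintype m] [DecidableEq m]

/-- `E₀(cA) = c E₀(A)` for Hermitian `A` and `c > 0` (variational characterisation of the ground
energy in both directions). Tasaki (2020) §2.1. [folklore] -/
theorem groundEnergy_smul_of_pos [Nonempty m] {A : Matrix m m ℂ} (hA : A.IsHermitian) {c : ℝ}
    (hc : 0 < c) : ((c : ℂ) • A).groundEnergy = c * A.groundEnergy := by
  have hcA : ((c : ℂ) • A).IsHermitian := hA.ofReal_smul c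
  have hray : ∀ ψ : m → ℂ, (star ψ ⬝ᵥ ((c : ℂ) • A) *ᵥ ψ).re = c * (star ψ ⬝ᵥ A *ᵥ ψ).re := by
    intro ψ
    rw [smul_mulVec, dotProduct_smul, smul_eq_mul, Complex.re_ofReal_mul]
  refine le_antisymm ?_ ?_
  · obtain ⟨ψ, hψ1, hψE⟩ := exists_groundState_unit hA
    have h := groundEnergy_le_rayleigh_holds hcA ψ hψ1
    rw [hray, hψE] at h
    exact h
  · obtain ⟨ψ, hψ1, hψE⟩ := exists_groundState_unit hcA
    have h := groundEnergy_le_rayleigh_holds hA ψ hψ1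
    rw [← hψE, hray]
    exact mul_le_mul_of_nonneg_left h hc.le

/-- The ground space is unchanged under `A ↦ cA`, `c > 0`. [folklore] -/
theorem groundSpace_smul_of_pos [Nonempty m] {A : Matrix m m ℂ} (hA : A.IsHermitian) {c : ℝ}
    (hc : 0 < c) : ((c : ℂ) • A).groundSpace = A.groundSpace := by
  ext v
  have hc0 : (c : ℂ) ≠ 0 := Complex.ofReal_ne_zero.2 hc.ne'
  rw [mem_groundSpace_iff, mem_groundSpace_iff, groundEnergy_smul_of_pos hA hc, smul_mulVec,
    Complex.ofReal_mul, mul_smul]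
  constructor
  · intro h
    exact smul_right_injective (m → ℂ) hc0 h
  · intro h
    rw [h]

/-- The ground-state projection is unchanged under `A ↦ cA`, `c > 0`. [folklore] -/
theorem groundProj_smul_of_pos [Nonempty m] {A : Matrix m m ℂ} (hA : A.IsHermitian) {c : ℝ}
    (hc : 0 < c) : ((c : ℂ) • A).groundProj = A.groundProj := by
  rw [groundProj_eq, groundProj_eq, groundSpace_smul_of_pos hA hc]

/-- **The tracial ground state is unchanged under `A ↦ cA`, `c > 0`** (same ground space).
Tasaki (2020) §2.1. [folklore] -/
theorem groundStateFunctional_smul_of_pos [Nonempty m] {A : Matrix m m ℂ} (hA : A.IsHermitian)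
    {c : ℝ} (hc : 0 < c) : ((c : ℂ) • A).groundStateFunctional = A.groundStateFunctional := by
  ext O
  rw [groundStateFunctional_apply, groundStateFunctional_apply, groundProj_smul_of_pos hA hc]

end Matrix

namespace Literature.MathematicalPhysics.QuantumLattice

variable {d : ℕ}

/-! ### The objects: Néel momentum, ground-state correlations, structure factor, bond correlation -/

/-- The antiferromagnetic (Néel) point `Q = (π, …, π)` of the dual torus, as the index
`(L/2, …, L/2) ∈ (ℤ/Lℤ)^d` (`latticeMomentum L (neelIndex L) i = π` for even `L`).
[Kennedy–Lieb–Shastry 1988, p. 1021: "By Q we denote either (π, π) or (π, π, π)"]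
[cite: KLS1988JSP, p. 1021] -/
def neelIndex (L : ℕ) : TorusSite d L := fun _ => ((L / 2 : ℕ) : ZMod L)

/-- The ground-state `α–α` correlation `Gᵅ_L(x,y) = Re ω(Sᵅ_x Sᵅ_y)` of the Heisenberg
antiferromagnet `heisenbergTorus d L n 1 = Σ_{⟨xy⟩} 𝐒_x · 𝐒_y` on `(ℤ/Lℤ)^d` (tracial ground-state
functional; junk `0` at `L = 0`). [Kennedy–Lieb–Shastry 1988, p. 1021, the two-point function]
[cite: KLS1988JSP, p. 1021] -/
def heisGroundCorr (α : Fin 3) (L n : ℕ) (x y : TorusSite d L) : ℝ :=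
  if hL : L = 0 then 0
  else
    haveI : NeZero L := ⟨hL⟩
    ((heisenbergTorus d L n 1).groundStateFunctional (siteSpin n x α * siteSpin n y α)).re

/-- The ground-state structure factor `ĝᵅ_q = ⟨Ŝᵅ_{-q} Ŝᵅ_q⟩ = |Λ|⁻¹ Σ_{x,y} cos(q·(x-y)) Gᵅ(x,y)`
(`Ŝ_q = |Λ|^{-1/2} Σ_x e^{-iq·x} S_x`), momenta indexed by the dual torus point `k`, `q = 2πk/L`;
junk `0` at `L = 0`. [Kennedy–Lieb–Shastry 1988, p. 1021, `g_q`] [cite: KLS1988JSP, p. 1021] -/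
def heisStructureFactor (α : Fin 3) (L n : ℕ) (k : TorusSite d L) : ℝ :=
  if hL : L = 0 then 0
  else
    haveI : NeZero L := ⟨hL⟩
    (∑ x : TorusSite d L, ∑ y : TorusSite d L,
        Real.cos (torusPhase L k (x - y)) * heisGroundCorr α L n x y) / (L : ℝ) ^ d

/-- The nearest-neighbour ground-state correlation per spin component, averaged over sites and
lattice directions: `εᵅ = (d L^d)⁻¹ Σ_x Σᵢ Gᵅ_L(x, x + eᵢ)`; KLS's `⟨S³_0 S³_{δᵢ}⟩ = -e₀/(3d)`
(independent of `i` and of the component). Junk `0` at `L = 0` or `d = 0`.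
[Kennedy–Lieb–Shastry 1988, eq. (3)] [cite: KLS1988JSP, eq. (3)] -/
def heisBondCorr (α : Fin 3) (L n : ℕ) : ℝ :=
  if hL : L = 0 then 0
  else
    haveI : NeZero L := ⟨hL⟩
    (∑ x : TorusSite d L, ∑ i : Fin d, heisGroundCorr α L n x (x + Pi.single i 1)) /
      ((d : ℝ) * (L : ℝ) ^ d)

/-! ### Unfolding lemmas -/

/-- Junk side. [folklore] -/
@[simp] theorem heisGroundCorr_zero_side (α : Fin 3) (n : ℕ) (x y : TorusSite d 0) :
    heisGroundCorr α 0 n x y = 0 := by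
  simp [heisGroundCorr]

/-- Unfolding on a genuine torus. [folklore] -/
theorem heisGroundCorr_of_neZero (α : Fin 3) (L : ℕ) [NeZero L] (n : ℕ) (x y : TorusSite d L) :
    heisGroundCorr α L n x y =
      ((heisenbergTorus d L n 1).groundStateFunctional (siteSpin n x α * siteSpin n y α)).re := by
  simp [heisGroundCorr, NeZero.ne L]

/-- Unfolding the structure factor on a genuine torus. [folklore] -/
theorem heisStructureFactor_of_neZero (α : Fin 3) (L : ℕ) [NeZero L] (n : ℕ)
    (k : TorusSite d L) :
    heisStructureFactor α L n k =
      (∑ x : TorusSite d L, ∑ y : TorusSite d L,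
        Real.cos (torusPhase L k (x - y)) * heisGroundCorr α L n x y) / (L : ℝ) ^ d := by
  simp [heisStructureFactor, NeZero.ne L]

/-- Unfolding the bond correlation on a genuine torus. [folklore] -/
theorem heisBondCorr_of_neZero (α : Fin 3) (L : ℕ) [NeZero L] (n : ℕ) :
    heisBondCorr (d := d) α L n =
      (∑ x : TorusSite d L, ∑ i : Fin d, heisGroundCorr α L n x (x + Pi.single i 1)) /
        ((d : ℝ) * (L : ℝ) ^ d) := by
  simp [heisBondCorr, NeZero.ne L]

/-- The antiferromagnetic Heisenberg torus Hamiltonian is Hermitian. [folklore] -/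
theorem heisenbergTorus_isHermitian (d L : ℕ) [NeZero L] (n : ℕ) (J : ℝ) :
    (heisenbergTorus d L n J).IsHermitian :=
  heisenbergHamiltonian_isHermitian n _ J

/-- `H_J = J • H₁`. [folklore] -/
theorem heisenbergTorus_eq_smul (d L : ℕ) [NeZero L] (n : ℕ) (J : ℝ) :
    heisenbergTorus d L n J = (J : ℂ) • heisenbergTorus d L n 1 := by
  simp only [heisenbergTorus, heisenbergHamiltonian, Complex.ofReal_one, one_smul]

/-- **Reduction to `J = 1`.** For `J > 0` the ground-state spin correlation of
`HeisenbergOrder.lean` is the sum over components of `heisGroundCorr`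
(`ω_{JH₁} = ω_{H₁}`). [Kennedy–Lieb–Shastry 1988, p. 1021] [folklore] -/
theorem groundStateSpinCorrTorus_eq_sum (L n : ℕ) {J : ℝ} (hJ : 0 < J) (x y : TorusSite d L) :
    groundStateSpinCorrTorus L n J x y = ∑ α : Fin 3, heisGroundCorr α L n x y := by
  rcases Nat.eq_zero_or_pos L with rfl | hL
  · simp
  haveI : NeZero L := ⟨hL.ne'⟩
  rw [groundStateSpinCorrTorus_of_neZero, heisenbergTorus_eq_smul,
    Matrix.groundStateFunctional_smul_of_pos (heisenbergTorus_isHermitian d L n 1) hJ,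
    Complex.re_sum]
  exact sum_congr rfl fun α _ => (heisGroundCorr_of_neZero α L n x y).symm

/-- The ground-state two-point function is symmetric: `Gᵅ(x,y) = Gᵅ(y,x)`. [folklore] -/
theorem heisGroundCorr_symm (α : Fin 3) (L n : ℕ) (x y : TorusSite d L) :
    heisGroundCorr α L n x y = heisGroundCorr α L n y x := by
  rcases Nat.eq_zero_or_pos L with rfl | hL
  · simp
  haveI : NeZero L := ⟨hL.ne'⟩
  rw [heisGroundCorr_of_neZero, heisGroundCorr_of_neZero]
  have h : siteSpin n y α * siteSpin n x α = (siteSpin n x α * siteSpin n y α)ᴴ := by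
    rw [conjTranspose_mul, (siteSpin_isHermitian n x α).eq, (siteSpin_isHermitian n y α).eq]
  rw [h, groundStateFunctional_conjTranspose_re]

/-! ### (I) Isotropy of the ground-state correlations -/

section Isotropy

variable {Λ : Type*} [Fintype Λ] [DecidableEq Λ]

/-- The global quarter turn about the `3`-axis fixes every exchange operator `𝐒_x · 𝐒_y`.
Tasaki (2020) §2.5 (`SU(2)` invariance). [folklore] -/
theorem quarterTurn_conj_spinDot (n : ℕ) (x y : Λ) :
    productOp (fun _ : Λ => diagonal fun k : Fin (n + 1) => (-Complex.I) ^ (k : ℕ)) *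
        spinDot n x y *
        (productOp (fun _ : Λ => diagonal fun k : Fin (n + 1) => (-Complex.I) ^ (k : ℕ)))ᴴ =
      spinDot n x y := by
  rw [spinDot, Fin.sum_univ_three, mul_add, mul_add, add_mul, add_mul,
    quarterTurn_conj_spinBond_zero, quarterTurn_conj_spinBond_one, quarterTurn_conj_spinBond_two,
    add_comm (spinBond n 1 x y)]

/-- The global quarter turn about the `3`-axis commutes with the Heisenberg Hamiltonian on any
graph. Tasaki (2020) §2.5, eq. (2.5.2). [folklore] -/
theorem quarterTurn_conj_heisenbergHamiltonian (n : ℕ) (G : SimpleGraph Λ) [DecidableRel G.Adj]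
    (J : ℝ) :
    productOp (fun _ : Λ => diagonal fun k : Fin (n + 1) => (-Complex.I) ^ (k : ℕ)) *
        heisenbergHamiltonian n G J *
        (productOp (fun _ : Λ => diagonal fun k : Fin (n + 1) => (-Complex.I) ^ (k : ℕ)))ᴴ =
      heisenbergHamiltonian n G J := by
  rw [heisenbergHamiltonian, mul_smul_comm, smul_mul_assoc, mul_sum, sum_mul]
  congr 1
  refine Finset.sum_congr rfl fun e _ => ?_
  induction e using Sym2.ind with
  | h x y => rw [spinDotSym_mk, quarterTurn_conj_spinDot]

/-- For a unitary `V` with `V Sᶻ Vᴴ = Sˣ`, `V Sˣ Vᴴ = -Sᶻ`, `V Sʸ Vᴴ = Sʸ` (a quarter turn about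
the `2`-axis), the product unitary `⨂V` fixes every exchange operator. Tasaki (2020) §2.5.
[folklore] -/
theorem yTurn_conj_spinDot (n : ℕ) {V : Matrix (Fin (n + 1)) (Fin (n + 1)) ℂ}
    (hV : V * Vᴴ = 1) (hV' : Vᴴ * V = 1) (hVz : V * SpinOperators.spinZ n * Vᴴ = spinX n)
    (hVx : V * spinX n * Vᴴ = -SpinOperators.spinZ n) (hVy : V * spinY n * Vᴴ = spinY n)
    (x y : Λ) :
    productOp (fun _ : Λ => V) * spinDot n x y * (productOp (fun _ : Λ => V))ᴴ =
      spinDot n x y := by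
  have hu : ∀ z : Λ, (fun _ : Λ => V) z * ((fun _ : Λ => V) z)ᴴ = 1 := fun _ => hV
  have hu' : ∀ z : Λ, ((fun _ : Λ => V) z)ᴴ * (fun _ : Λ => V) z = 1 := fun _ => hV'
  have h0 : productOp (fun _ : Λ => V) * spinBond n 0 x y * (productOp (fun _ : Λ => V))ᴴ =
      spinBond n 2 x y := by
    rw [productOp_conj_spinBond hu hu', spinVec_zero, hVx, onSite_neg', onSite_neg', neg_mul_neg,
      neg_mul_neg, spinBond]
    rfl
  have h1 : productOp (fun _ : Λ => V) * spinBond n 1 x y * (productOp (fun _ : Λ => V))ᴴ =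
      spinBond n 1 x y := by
    rw [productOp_conj_spinBond hu hu', spinVec_one, hVy, spinBond]
    rfl
  have h2 : productOp (fun _ : Λ => V) * spinBond n 2 x y * (productOp (fun _ : Λ => V))ᴴ =
      spinBond n 0 x y := by
    rw [productOp_conj_spinBond hu hu', spinVec_two, hVz, spinBond]
    rfl
  rw [spinDot, Fin.sum_univ_three, mul_add, mul_add, add_mul, add_mul, h0, h1, h2]
  abel

/-- The quarter turn about the `2`-axis commutes with the Heisenberg Hamiltonian on any graph.
Tasaki (2020) §2.5, eq. (2.5.2). [folklore] -/
theorem yTurn_conj_heisenbergHamiltonian (n : ℕ) (G : SimpleGraph Λ) [DecidableRel G.Adj]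
    (J : ℝ) {V : Matrix (Fin (n + 1)) (Fin (n + 1)) ℂ}
    (hV : V * Vᴴ = 1) (hV' : Vᴴ * V = 1) (hVz : V * SpinOperators.spinZ n * Vᴴ = spinX n)
    (hVx : V * spinX n * Vᴴ = -SpinOperators.spinZ n) (hVy : V * spinY n * Vᴴ = spinY n) :
    productOp (fun _ : Λ => V) * heisenbergHamiltonian n G J * (productOp (fun _ : Λ => V))ᴴ =
      heisenbergHamiltonian n G J := by
  rw [heisenbergHamiltonian, mul_smul_comm, smul_mul_assoc, mul_sum, sum_mul]
  congr 1
  refine Finset.sum_congr rfl fun e _ => ?_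
  induction e using Sym2.ind with
  | h x y => rw [spinDotSym_mk, yTurn_conj_spinDot n hV hV' hVz hVx hVy]

end Isotropy

/-- **(I) Isotropy, `1 ↔ 2`**: `⟨S¹_xS¹_y⟩ = ⟨S²_xS²_y⟩` in the tracial ground state of the
Heisenberg antiferromagnet (invariance under the quarter turn about the `3`-axis).
[Kennedy–Lieb–Shastry 1988, p. 1021 ("the expectation of `S³_xS³_y` is one-third of the
expectation of `𝐒_x · 𝐒_y`")] [folklore] -/
theorem heisGroundCorr_one_eq_zero (L n : ℕ) (x y : TorusSite d L) :
    heisGroundCorr 1 L n x y = heisGroundCorr 0 L n x y := by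
  rcases Nat.eq_zero_or_pos L with rfl | hL
  · simp
  haveI : NeZero L := ⟨hL.ne'⟩
  rw [heisGroundCorr_of_neZero, heisGroundCorr_of_neZero]
  set U : Op (TorusSite d L) (n + 1) :=
    productOp (fun _ : TorusSite d L => diagonal fun k : Fin (n + 1) => (-Complex.I) ^ (k : ℕ))
    with hU
  have hUU : Uᴴ * U = 1 := productOp_conjTranspose_mul fun _ => spinPhase_conjTranspose_mul n
  have hcomm : U * heisenbergTorus d L n 1 = heisenbergTorus d L n 1 * U := by
    have h := quarterTurn_conj_heisenbergHamiltonian n (torusGraph d L) 1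
    have h2 := congrArg (· * U) h
    simp only at h2
    rw [mul_assoc, hUU, mul_one] at h2
    exact h2
  have hinv := groundStateFunctional_conj_of_commute (heisenbergTorus_isHermitian d L n 1) hcomm
    hUU (siteSpin n x 1 * siteSpin n y 1)
  rw [productOp_conj_mul (fun _ => spinPhase_conjTranspose_mul n),
    quarterTurn_conj_siteSpin_one, quarterTurn_conj_siteSpin_one] at hinv
  rw [hinv]

/-- **(I) Isotropy, `3 ↔ 1`**: `⟨S³_xS³_y⟩ = ⟨S¹_xS¹_y⟩` in the tracial ground state of the
Heisenberg antiferromagnet (invariance under the quarter turn about the `2`-axis, which maps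
`Sᶻ ↦ Sˣ`). [Kennedy–Lieb–Shastry 1988, p. 1021] [folklore] -/
theorem heisGroundCorr_two_eq_zero (L n : ℕ) (x y : TorusSite d L) :
    heisGroundCorr 2 L n x y = heisGroundCorr 0 L n x y := by
  rcases Nat.eq_zero_or_pos L with rfl | hL
  · simp
  haveI : NeZero L := ⟨hL.ne'⟩
  rw [heisGroundCorr_of_neZero, heisGroundCorr_of_neZero]
  obtain ⟨V, hV, hV', hVz, hVx, hVy⟩ := exists_unitary_conj_spinZ_eq_spinX n
  set U : Op (TorusSite d L) (n + 1) := productOp (fun _ : TorusSite d L => V) with hU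
  have hUU : Uᴴ * U = 1 := productOp_conjTranspose_mul fun _ => hV'
  have hcomm : U * heisenbergTorus d L n 1 = heisenbergTorus d L n 1 * U := by
    have h := yTurn_conj_heisenbergHamiltonian n (torusGraph d L) 1 hV hV' hVz hVx hVy
    have h2 := congrArg (· * U) h
    simp only at h2
    rw [mul_assoc, hUU, mul_one] at h2
    exact h2
  have hinv := groundStateFunctional_conj_of_commute (heisenbergTorus_isHermitian d L n 1) hcomm
    hUU (siteSpin n x 2 * siteSpin n y 2)
  have hz : U * siteSpin n x 2 * Uᴴ = siteSpin n x 0 := by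
    rw [hU, productOp_conj_siteSpin (fun _ => hV), spinVec_two, hVz]
    rfl
  have hz' : U * siteSpin n y 2 * Uᴴ = siteSpin n y 0 := by
    rw [hU, productOp_conj_siteSpin (fun _ => hV), spinVec_two, hVz]
    rfl
  rw [hU, productOp_conj_mul (fun _ => hV'), ← hU, hz, hz'] at hinv
  rw [hinv]

/-- **(I) Isotropy**: all three components have the same ground-state correlations.
[Kennedy–Lieb–Shastry 1988, p. 1021] [folklore] -/
theorem heisGroundCorr_eq_zero_comp (α : Fin 3) (L n : ℕ) (x y : TorusSite d L) :
    heisGroundCorr α L n x y = heisGroundCorr 0 L n x y := by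
  fin_cases α
  · rfl
  · exact heisGroundCorr_one_eq_zero L n x y
  · exact heisGroundCorr_two_eq_zero L n x y

/-- Isotropy of the structure factor. [folklore] -/
theorem heisStructureFactor_eq_zero_comp (α : Fin 3) (L n : ℕ) (k : TorusSite d L) :
    heisStructureFactor α L n k = heisStructureFactor 0 L n k := by
  rcases Nat.eq_zero_or_pos L with rfl | hL
  · simp [heisStructureFactor]
  haveI : NeZero L := ⟨hL.ne'⟩
  simp only [heisStructureFactor_of_neZero, heisGroundCorr_eq_zero_comp α]

/-! ### (T) The a priori bound `|Gᵅ(x,y)| ≤ S²` -/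

section BoundT

open scoped ComplexOrder

/-- **(T)** `|Re ω(Sᵅ_x Sᵅ_y)| ≤ S²` for the tracial ground state of ANY Hermitian Hamiltonian
(`S²·1 ∓ Sᵅ_xSᵅ_y ≥ 0` and `ω` is a normalised positive functional). [folklore] -/
theorem abs_re_groundStateFunctional_siteSpin_mul_le {Λ : Type*} [Fintype Λ] [DecidableEq Λ]
    {n : ℕ} {H : Op Λ (n + 1)} (hH : H.IsHermitian) (α : Fin 3) (x y : Λ) :
    |(H.groundStateFunctional (siteSpin n x α * siteSpin n y α)).re| ≤ ((n : ℝ) / 2) ^ 2 := by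
  have hone : H.groundStateFunctional 1 = 1 := groundStateFunctional_one hH
  have hup := groundStateFunctional_nonneg_of_posSemidef H
    (posSemidef_sq_smul_one_sub_siteSpin_mul' n x y α)
  rw [map_sub, LinearMap.map_smul, hone, smul_eq_mul, mul_one] at hup
  obtain ⟨hup_re, -⟩ := Complex.nonneg_iff.mp hup
  rw [Complex.sub_re, re_half_sq] at hup_re
  have hlo := groundStateFunctional_nonneg_of_posSemidef H
    (posSemidef_sq_smul_one_add_siteSpin_mul' n x y α)
  rw [map_add, LinearMap.map_smul, hone, smul_eq_mul, mul_one] at hlo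
  obtain ⟨hlo_re, -⟩ := Complex.nonneg_iff.mp hlo
  rw [Complex.add_re, re_half_sq] at hlo_re
  rw [abs_le]
  constructor <;> linarith

/-- **(T)** for the Heisenberg antiferromagnet: `|Gᵅ_L(x,y)| ≤ S²`. [folklore] -/
theorem heisGroundCorr_abs_le (α : Fin 3) (L n : ℕ) (x y : TorusSite d L) :
    |heisGroundCorr α L n x y| ≤ ((n : ℝ) / 2) ^ 2 := by
  rcases Nat.eq_zero_or_pos L with rfl | hL
  · simp only [heisGroundCorr_zero_side, abs_zero]
    positivity
  haveI : NeZero L := ⟨hL.ne'⟩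
  rw [heisGroundCorr_of_neZero]
  exact abs_re_groundStateFunctional_siteSpin_mul_le (heisenbergTorus_isHermitian d L n 1) α x y

end BoundT


/-! ### The Néel momentum on even tori -/

section Neel

variable (k : ℕ) [NeZero (2 * k)]

omit [NeZero (2 * k)] in
/-- `1 ≤ k` from `2k ≠ 0`. [folklore] -/
theorem one_le_of_neZero_two_mul [h : NeZero (2 * k)] : 1 ≤ k := by
  have := h.ne
  omega

/-- The components of the Néel index of the even torus `(ℤ/2kℤ)^d` have canonical representative
`k`. [folklore] -/
theorem neelIndex_val (i : Fin d) : ((neelIndex (2 * k) : TorusSite d (2 * k)) i).val = k := by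
  have hk := one_le_of_neZero_two_mul k
  simp only [neelIndex, Nat.mul_div_cancel_left k two_pos, ZMod.val_natCast]
  exact Nat.mod_eq_of_lt (by omega)

omit [NeZero (2 * k)] in
/-- Components of the Néel index. [folklore] -/
theorem neelIndex_apply (i : Fin d) :
    (neelIndex (2 * k) : TorusSite d (2 * k)) i = ((k : ℕ) : ZMod (2 * k)) := by
  simp only [neelIndex, Nat.mul_div_cancel_left k two_pos]

omit [NeZero (2 * k)] in
/-- `-k = k` in `ℤ/2kℤ`. [folklore] -/
theorem neg_natCast_half : -((k : ℕ) : ZMod (2 * k)) = ((k : ℕ) : ZMod (2 * k)) := by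
  rw [neg_eq_iff_add_eq_zero, ← Nat.cast_add, ← two_mul, ZMod.natCast_self]

omit [NeZero (2 * k)] in
/-- `Q = -Q` on the even torus (`k + k = 2k ≡ 0`). [folklore] -/
theorem neg_neelIndex : -(neelIndex (2 * k) : TorusSite d (2 * k)) = neelIndex (2 * k) := by
  funext i
  rw [Pi.neg_apply, neelIndex_apply, neg_natCast_half]

/-- `Qᵢ = π`: the lattice momentum of the Néel index. [Kennedy–Lieb–Shastry 1988, p. 1021]
[folklore] -/
theorem latticeMomentum_neelIndex (i : Fin d) :
    latticeMomentum (2 * k) (neelIndex (2 * k) : TorusSite d (2 * k)) i = Real.pi := by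
  have hk := one_le_of_neZero_two_mul k
  rw [latticeMomentum_apply, neelIndex_val k]
  have hk0 : (k : ℝ) ≠ 0 := by exact_mod_cast (show k ≠ 0 by omega)
  push_cast
  field_simp

/-- `Σᵢ cos Qᵢ = -d`. [folklore] -/
theorem torusCosSum_neelIndex :
    torusCosSum (2 * k) (neelIndex (2 * k) : TorusSite d (2 * k)) = -(d : ℝ) := by
  simp only [torusCosSum, latticeMomentum_neelIndex k, Real.cos_pi, sum_const, card_univ,
    Fintype.card_fin, nsmul_eq_mul, mul_neg, mul_one]

/-- `cos(Q·z) = (-1)^{Σᵢ zᵢ}` on canonical representatives of the even torus.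
[Dyson–Lieb–Simon 1978, §1 (the substitution `p ↦ (π,…,π) - p`)] [folklore] -/
theorem cos_torusPhase_neelIndex (z : TorusSite d (2 * k)) :
    Real.cos (torusPhase (2 * k) (neelIndex (2 * k)) z) = (-1 : ℝ) ^ (∑ i, (z i).val) := by
  have hk := one_le_of_neZero_two_mul k
  have hk0 : (k : ℝ) ≠ 0 := by exact_mod_cast (show k ≠ 0 by omega)
  have h : torusPhase (2 * k) (neelIndex (2 * k)) z = ((∑ i, (z i).val : ℕ) : ℝ) * Real.pi := by
    unfold torusPhase
    simp only [neelIndex_val k]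
    rw [← mul_sum]
    push_cast
    field_simp
  rw [h, Real.cos_nat_mul_pi]

omit [NeZero (2 * k)] in
/-- `cos pᵢ = Re e(qᵢ)` for the standard character `e` of `ℤ/Lℤ`. [folklore] -/
theorem cos_latticeMomentum_eq_stdAddChar_re (L : ℕ) [NeZero L] (q : TorusSite d L) (i : Fin d) :
    Real.cos (latticeMomentum L q i) = ((ZMod.stdAddChar (q i) : ℂ)).re := by
  rw [← torusChar_single_re]
  congr 1
  rw [← prod_erase_mul _ _ (mem_univ i), Pi.single_eq_same, mul_one, prod_eq_one, one_mul]
  intro j hj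
  rw [Pi.single_eq_of_ne (ne_of_mem_erase hj), mul_zero, AddChar.map_zero_eq_one]

/-- `e(k) = -1` on `ℤ/2kℤ`. [folklore] -/
theorem stdAddChar_half : (ZMod.stdAddChar ((k : ℕ) : ZMod (2 * k)) : ℂ) = -1 := by
  have hk := one_le_of_neZero_two_mul k
  rw [ZMod.stdAddChar_apply, ZMod.toCircle_natCast]
  have hk0 : (k : ℂ) ≠ 0 := by exact_mod_cast (show k ≠ 0 by omega)
  have : (2 * Real.pi * Complex.I * (k : ℕ) / ((2 * k : ℕ) : ℂ)) = Real.pi * Complex.I := by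
    push_cast
    field_simp
  rw [this, Complex.exp_pi_mul_I]

/-- The shift by `Q` flips every cosine: `cos (q - Q)ᵢ = -cos qᵢ`. [Kennedy–Lieb–Shastry 1988,
p. 1022 (the substitution in (4))] [folklore] -/
theorem cos_latticeMomentum_sub_neelIndex (q : TorusSite d (2 * k)) (i : Fin d) :
    Real.cos (latticeMomentum (2 * k) (q - neelIndex (2 * k)) i) =
      -Real.cos (latticeMomentum (2 * k) q i) := by
  rw [cos_latticeMomentum_eq_stdAddChar_re, cos_latticeMomentum_eq_stdAddChar_re, Pi.sub_apply,
    neelIndex_apply, sub_eq_add_neg, neg_natCast_half, AddChar.map_add_eq_mul, stdAddChar_half,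
    mul_neg, mul_one, Complex.neg_re]

/-- `E_q = d - C_q`. [folklore] -/
theorem dispersion_latticeMomentum_eq (L : ℕ) (q : TorusSite d L) :
    dispersion (latticeMomentum L q) = d - torusCosSum L q := by
  have h := sum_const_sub_mul_cos_latticeMomentum L q 1 1
  simp only [one_mul, mul_one] at h
  exact h

/-- `E_{q-Q} = d + C_q` (`= Σᵢ (1 + cos qᵢ)`). [Kennedy–Lieb–Shastry 1988, eq. (1)] [folklore] -/
theorem dispersion_latticeMomentum_sub_neelIndex (q : TorusSite d (2 * k)) :
    dispersion (latticeMomentum (2 * k) (q - neelIndex (2 * k))) = d + torusCosSum (2 * k) q := by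
  rw [← sum_one_add_cos_latticeMomentum, dispersion]
  exact sum_congr rfl fun i _ => by rw [cos_latticeMomentum_sub_neelIndex k, sub_neg_eq_add]

/-- `C_{q-Q} = -C_q`. [folklore] -/
theorem torusCosSum_sub_neelIndex (q : TorusSite d (2 * k)) :
    torusCosSum (2 * k) (q - neelIndex (2 * k)) = -torusCosSum (2 * k) q := by
  simp only [torusCosSum, cos_latticeMomentum_sub_neelIndex k, sum_neg_distrib]

/-- **The integrand of (4) is the XY integrand after the shift `q = p + Q`**:
`(E_q/E_{q-Q})^{1/2} d⁻¹(-Σᵢ cos qᵢ)₊ = klsIntegrand d (p)`, `p = q - Q`.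
[Kennedy–Lieb–Shastry 1988, eq. (4)] [cite: KLS1988JSP, eq. (4)] -/
theorem klsIntegrand_latticeMomentum_sub_neelIndex (q : TorusSite d (2 * k)) :
    klsIntegrand d (latticeMomentum (2 * k) (q - neelIndex (2 * k))) =
      Real.sqrt (dispersion (latticeMomentum (2 * k) q) / (d + torusCosSum (2 * k) q)) *
        max (-torusCosSum (2 * k) q / d) 0 := by
  rw [klsIntegrand_latticeMomentum, dispersion_latticeMomentum_sub_neelIndex k,
    torusCosSum_sub_neelIndex k, dispersion_latticeMomentum_eq, sub_eq_add_neg]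

end Neel

/-! ### The staggering sign on the even torus -/

section Sign

/-- `(-1)^{(a+b).val} = (-1)^{a.val} (-1)^{b.val}` on `ℤ/2kℤ` (the sign `(-1)^{val}` is a
character of the even cyclic group). [Dyson–Lieb–Simon 1978, §1] [folklore] -/
theorem neg_one_pow_val_add (k : ℕ) [NeZero (2 * k)] (a b : ZMod (2 * k)) :
    (-1 : ℝ) ^ (a + b).val = (-1) ^ a.val * (-1) ^ b.val := by
  rw [ZMod.val_add, ← pow_add]
  conv_rhs => rw [← Nat.div_add_mod (a.val + b.val) (2 * k), pow_add, pow_mul, pow_mul,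
    neg_one_sq, one_pow, one_pow, one_mul]

/-- `(-1)^{(-a).val} = (-1)^{a.val}` on `ℤ/2kℤ`. [folklore] -/
theorem neg_one_pow_val_neg (k : ℕ) [NeZero (2 * k)] (a : ZMod (2 * k)) :
    (-1 : ℝ) ^ (-a).val = (-1) ^ a.val := by
  rw [ZMod.neg_val]
  split_ifs with h
  · rw [h, ZMod.val_zero]
  · have hle : a.val ≤ 2 * k := (ZMod.val_lt a).le
    have h1 : (-1 : ℝ) ^ (2 * k - a.val) * (-1) ^ a.val = 1 := by
      rw [← pow_add, Nat.sub_add_cancel hle, pow_mul, neg_one_sq, one_pow]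
    have h2 : (-1 : ℝ) ^ a.val * (-1) ^ a.val = 1 := by
      rw [← pow_add, ← two_mul, pow_mul, neg_one_sq, one_pow]
    calc (-1 : ℝ) ^ (2 * k - a.val) = (-1) ^ (2 * k - a.val) * ((-1) ^ a.val * (-1) ^ a.val) := by
          rw [h2, mul_one]
      _ = ((-1) ^ (2 * k - a.val) * (-1) ^ a.val) * (-1) ^ a.val := by ring
      _ = (-1) ^ a.val := by rw [h1, one_mul]

/-- **The staggering sign is a character of the even torus**:
`(-1)^{Σᵢ (x-y)ᵢ} = (-1)^{Σᵢ xᵢ} (-1)^{Σᵢ yᵢ}` on canonical representatives.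
[Dyson–Lieb–Simon 1978, §1 ("Λ a cube of even side")] [folklore] -/
theorem neg_one_pow_sum_val_sub (k : ℕ) [NeZero (2 * k)] (x y : TorusSite d (2 * k)) :
    (-1 : ℝ) ^ (∑ i, ((x - y) i).val) = (-1) ^ (∑ i, (x i).val) * (-1) ^ (∑ i, (y i).val) := by
  rw [← prod_pow_eq_pow_sum, ← prod_pow_eq_pow_sum, ← prod_pow_eq_pow_sum, ← prod_mul_distrib]
  refine prod_congr rfl fun i _ => ?_
  rw [Pi.sub_apply, sub_eq_add_neg, neg_one_pow_val_add, neg_one_pow_val_neg]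

/-- `cos(Q·(x-y)) = (-1)^{Σxᵢ} (-1)^{Σyᵢ}` on the even torus. [Dyson–Lieb–Simon 1978, §1]
[folklore] -/
theorem cos_torusPhase_neelIndex_sub (k : ℕ) [NeZero (2 * k)] (x y : TorusSite d (2 * k)) :
    Real.cos (torusPhase (2 * k) (neelIndex (2 * k)) (x - y)) =
      (-1 : ℝ) ^ (∑ i, (x i).val) * (-1) ^ (∑ i, (y i).val) := by
  rw [cos_torusPhase_neelIndex k, neg_one_pow_sum_val_sub]

end Sign

/-! ### The Néel order parameter of `HeisenbergOrder.lean` is `3 |Λ|⁻¹ ĝ_Q` -/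

section OrderParameter

/-- **The Néel order parameter.** On the even torus of side `L = 2k ≥ 2` and for `J > 0`, the
staggered, volume-normalised double sum of the ground-state correlation `⟨𝐒_x · 𝐒_y⟩` of
`HeisenbergOrder.lean` is `3 |Λ|⁻¹ ĝ_Q` (isotropy (I) and `cos(Q·(x-y)) = (-1)^{x}(-1)^{y}`).
[Kennedy–Lieb–Shastry 1988, p. 1021 ("Néel order corresponds to `g_q` containing a `δ` function at
`Q`"; the factor `3` from the three components)] [cite: KLS1988JSP, p. 1021] -/
theorem neelSum_eq (n k : ℕ) [NeZero (2 * k)] {J : ℝ} (hJ : 0 < J) :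
    (∑ x : TorusSite d (2 * k), ∑ y : TorusSite d (2 * k),
        (-1 : ℝ) ^ (∑ i, (x i).val) * (-1) ^ (∑ i, (y i).val) *
          groundStateSpinCorrTorus (2 * k) n J x y) / ((2 * k : ℕ) : ℝ) ^ (2 * d) =
      3 * (heisStructureFactor 0 (2 * k) n (neelIndex (2 * k) : TorusSite d (2 * k)) /
        ((2 * k : ℕ) : ℝ) ^ d) := by
  have h2k : ((2 * k : ℕ) : ℝ) ≠ 0 := by exact_mod_cast NeZero.ne (2 * k)
  have hL : ((2 * k : ℕ) : ℝ) ^ d ≠ 0 := pow_ne_zero _ h2k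
  rw [heisStructureFactor_of_neZero, div_div, ← pow_add, show d + d = 2 * d by ring, mul_div_assoc',
    mul_sum]
  congr 1
  refine sum_congr rfl fun x _ => ?_
  rw [mul_sum]
  refine sum_congr rfl fun y _ => ?_
  rw [cos_torusPhase_neelIndex_sub k, groundStateSpinCorrTorus_eq_sum _ _ hJ, Fin.sum_univ_three,
    heisGroundCorr_one_eq_zero, heisGroundCorr_two_eq_zero]
  ring

/-- The order-parameter sequence is bounded: `|L^{-2d} Σ_{x,y} ± ⟨𝐒_x·𝐒_y⟩| ≤ 3S²` (from (T)).
[folklore] -/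
theorem neelSum_le (n L : ℕ) [NeZero L] {J : ℝ} (hJ : 0 < J) :
    (∑ x : TorusSite d L, ∑ y : TorusSite d L,
        (-1 : ℝ) ^ (∑ i, (x i).val) * (-1) ^ (∑ i, (y i).val) *
          groundStateSpinCorrTorus L n J x y) / (L : ℝ) ^ (2 * d) ≤ 3 * ((n : ℝ) / 2) ^ 2 := by
  have hc : 0 ≤ 3 * ((n : ℝ) / 2) ^ 2 := by positivity
  have hL0 : (0 : ℝ) < L := by exact_mod_cast Nat.pos_of_ne_zero (NeZero.ne L)
  have hLpos : (0 : ℝ) < (L : ℝ) ^ (2 * d) := by positivity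
  rw [div_le_iff₀ hLpos]
  have hb : ∀ x y : TorusSite d L, (-1 : ℝ) ^ (∑ i, (x i).val) * (-1) ^ (∑ i, (y i).val) *
      groundStateSpinCorrTorus L n J x y ≤ 3 * ((n : ℝ) / 2) ^ 2 := by
    intro x y
    have h3 : |groundStateSpinCorrTorus L n J x y| ≤ 3 * ((n : ℝ) / 2) ^ 2 := by
      rw [groundStateSpinCorrTorus_eq_sum _ _ hJ]
      calc |∑ α : Fin 3, heisGroundCorr α L n x y| ≤ ∑ α : Fin 3, |heisGroundCorr α L n x y| :=
            abs_sum_le_sum_abs _ _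
        _ ≤ ∑ _α : Fin 3, ((n : ℝ) / 2) ^ 2 := sum_le_sum fun α _ => heisGroundCorr_abs_le α L n x y
        _ = 3 * ((n : ℝ) / 2) ^ 2 := by simp
    have hs : |(-1 : ℝ) ^ (∑ i, (x i).val) * (-1) ^ (∑ i, (y i).val)| = 1 := by
      rw [abs_mul, abs_neg_one_pow, abs_neg_one_pow, mul_one]
    have := abs_mul ((-1 : ℝ) ^ (∑ i, (x i).val) * (-1) ^ (∑ i, (y i).val))
      (groundStateSpinCorrTorus L n J x y)
    rw [hs, one_mul] at this
    exact (le_abs_self _).trans (this ▸ h3)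
  calc ∑ x : TorusSite d L, ∑ y : TorusSite d L, (-1 : ℝ) ^ (∑ i, (x i).val) *
        (-1) ^ (∑ i, (y i).val) * groundStateSpinCorrTorus L n J x y
      ≤ ∑ _x : TorusSite d L, ∑ _y : TorusSite d L, 3 * ((n : ℝ) / 2) ^ 2 :=
        sum_le_sum fun x _ => sum_le_sum fun y _ => hb x y
    _ = 3 * ((n : ℝ) / 2) ^ 2 * (L : ℝ) ^ (2 * d) := by
        rw [sum_const, sum_const, card_univ, nsmul_eq_mul, nsmul_eq_mul, Fintype.card_pi, prod_const,
          ZMod.card, card_univ, Fintype.card_fin]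
        push_cast
        ring

end OrderParameter


/-! ### (C) The sum rule -/

section SumRule

/-- **(C) The sum rule** (finite-volume Parseval form of Kennedy–Lieb–Shastry 1988, eq. (3)):
`|Λ|⁻¹ Σ_q ĝᵅ_q (d⁻¹ Σᵢ cos qᵢ) = εᵅ`, by orthogonality of the characters of `(ℤ/Lℤ)^d`
(`sum_structureFactor_mul_cos`) and the symmetry `Gᵅ(x,y) = Gᵅ(y,x)`.
[Kennedy–Lieb–Shastry 1988, eq. (3)] [cite: KLS1988JSP, eq. (3)] -/
theorem heis_structureFactor_sumRule (hd : 1 ≤ d) (α : Fin 3) (L : ℕ) [NeZero L] (n : ℕ) :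
    (∑ q : TorusSite d L, heisStructureFactor α L n q * (torusCosSum L q / d)) / (L : ℝ) ^ d =
      heisBondCorr (d := d) α L n := by
  have hd0 : (d : ℝ) ≠ 0 := by exact_mod_cast (show d ≠ 0 by omega)
  have hL0 : (L : ℝ) ^ d ≠ 0 := by
    have : (L : ℝ) ≠ 0 := by exact_mod_cast NeZero.ne L
    positivity
  simp_rw [heisStructureFactor_of_neZero, torusCosSum, heisBondCorr_of_neZero]
  have h : ∀ q : TorusSite d L,
      (∑ x : TorusSite d L, ∑ y : TorusSite d L,
          Real.cos (torusPhase L q (x - y)) * heisGroundCorr α L n x y) / (L : ℝ) ^ d *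
        ((∑ i : Fin d, Real.cos (latticeMomentum L q i)) / d) =
      (∑ i : Fin d, (∑ x : TorusSite d L, ∑ y : TorusSite d L,
          Real.cos (torusPhase L q (x - y)) * heisGroundCorr α L n x y) *
        Real.cos (latticeMomentum L q i)) / ((d : ℝ) * (L : ℝ) ^ d) := by
    intro q
    rw [div_mul_div_comm, mul_sum, mul_comm ((L : ℝ) ^ d) (d : ℝ)]
  simp_rw [h]
  rw [← sum_div, sum_comm]
  simp_rw [sum_structureFactor_mul_cos L (heisGroundCorr α L n) (heisGroundCorr_symm α L n)]
  rw [← mul_sum, sum_comm]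
  field_simp

/-- The sum rule with the Néel point split off: on the even torus of side `2k`,
`ε |Λ| = -ĝ_Q + Σ_{q ≠ Q} ĝ_q (d⁻¹ Σᵢ cos qᵢ)` (`Σᵢ cos Qᵢ = -d`).
[Kennedy–Lieb–Shastry 1988, eqs. (3)–(4)] [cite: KLS1988JSP, eqs. (3)–(4)] -/
theorem heis_sumRule_split (hd : 1 ≤ d) (α : Fin 3) (k : ℕ) [NeZero (2 * k)] (n : ℕ) :
    heisBondCorr (d := d) α (2 * k) n * ((2 * k : ℕ) : ℝ) ^ d =
      -heisStructureFactor α (2 * k) n (neelIndex (2 * k) : TorusSite d (2 * k)) +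
        ∑ q ∈ (univ : Finset (TorusSite d (2 * k))).erase (neelIndex (2 * k)),
          heisStructureFactor α (2 * k) n q * (torusCosSum (2 * k) q / d) := by
  have hd0 : (d : ℝ) ≠ 0 := by exact_mod_cast (show d ≠ 0 by omega)
  have h2k : ((2 * k : ℕ) : ℝ) ≠ 0 := by exact_mod_cast NeZero.ne (2 * k)
  have hL : ((2 * k : ℕ) : ℝ) ^ d ≠ 0 := pow_ne_zero _ h2k
  rw [← heis_structureFactor_sumRule hd α (2 * k) n, div_mul_cancel₀ _ hL,
    ← add_sum_erase _ _ (mem_univ (neelIndex (2 * k) : TorusSite d (2 * k))),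
    torusCosSum_neelIndex k, neg_div, div_self hd0, mul_neg, mul_one]

end SumRule

/-! ### (N) The Néel state as a trial state: `-ε ≥ S²/3` -/

section NeelBound

/-- Diagonal entries of `S⁺` vanish. [folklore] -/
theorem spinRaise_apply_self (n : ℕ) (k : Fin (n + 1)) : spinRaise n k k = 0 := by
  rw [spinRaise_apply, if_neg (by omega)]

/-- Diagonal entries of `Sˣ` vanish (private copy of the helper of
`Barriers/AtomisticToContinuum/HalfFillingEnergyProofs.lean`, which is not imported here).
Tasaki (2020) §2.1, eq. (2.1.6). [folklore] -/
private theorem spinX_diag_apply (n : ℕ) (k : Fin (n + 1)) : spinX n k k = 0 := by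
  rw [spinX, Matrix.smul_apply, Matrix.add_apply, spinLower_eq_conjTranspose, conjTranspose_apply,
    spinRaise_apply_self, star_zero, add_zero, smul_zero]

/-- Diagonal entries of `Sʸ` vanish. Tasaki (2020) §2.1, eq. (2.1.6). [folklore] -/
private theorem spinY_diag_apply (n : ℕ) (k : Fin (n + 1)) : spinY n k k = 0 := by
  rw [spinY, Matrix.smul_apply, Matrix.sub_apply, spinLower_eq_conjTranspose, conjTranspose_apply,
    spinRaise_apply_self, star_zero, sub_zero, smul_zero]

/-- `⟨n| Sᶻ |n⟩ = -S = -n/2` (the bottom weight). Tasaki (2020) §2.1, eq. (2.1.5). [folklore] -/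
theorem spinZ_apply_last_last (n : ℕ) :
    SpinOperators.spinZ n (Fin.last n) (Fin.last n) = -((n : ℂ) / 2) := by
  rw [spinZ_apply, if_pos rfl, Fin.val_last]
  ring

/-- **The Néel state has exchange energy `-S²` on every bond between the sublattices**: for a
configuration `σ` taking the values `0` (spin up) and `n` (spin down) at `x ≠ y`, respectively
(in either order), `⟨σ| 𝐒_x · 𝐒_y |σ⟩ = -S²` (`Sˣ`, `Sʸ` have no diagonal entries).
[Dyson–Lieb–Simon 1978, App. C; Kennedy–Lieb–Shastry 1988, p. 1022] [folklore] -/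
theorem spinDot_apply_neel {Λ : Type*} [Fintype Λ] [DecidableEq Λ] (n : ℕ) {x y : Λ} (hxy : x ≠ y)
    (σ : TensorIndex Λ (n + 1))
    (hσ : σ x = 0 ∧ σ y = Fin.last n ∨ σ x = Fin.last n ∧ σ y = 0) :
    spinDot n x y σ σ = -(((n : ℂ) / 2) ^ 2) := by
  rw [spinDot, Fin.sum_univ_three, Matrix.add_apply, Matrix.add_apply, spinBond_apply_self hxy,
    spinBond_apply_self hxy, spinBond_apply_self hxy, spinVec_zero, spinVec_one, spinVec_two,
    spinX_diag_apply, spinY_diag_apply, zero_mul, zero_mul, zero_add, zero_add]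
  rcases hσ with ⟨hx, hy⟩ | ⟨hx, hy⟩
  · rw [hx, hy, spinZ_apply_zero_zero, spinZ_apply_last_last]
    ring
  · rw [hx, hy, spinZ_apply_zero_zero, spinZ_apply_last_last]
    ring

/-- Real part of `ω` on a symmetrised bond: `Re ω(½(Sᵅ_x Sᵅ_y + Sᵅ_y Sᵅ_x)) = Gᵅ(x,y)`.
[folklore] -/
theorem re_groundStateFunctional_heis_spinBond (L : ℕ) [NeZero L] (n : ℕ) (α : Fin 3)
    (x y : TorusSite d L) :
    ((heisenbergTorus d L n 1).groundStateFunctional (spinBond n α x y)).re =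
      heisGroundCorr α L n x y := by
  rw [spinBond, LinearMap.map_smul, map_add, smul_eq_mul,
    show (1 / 2 : ℂ) = ((1 / 2 : ℝ) : ℂ) by push_cast; ring, Complex.re_ofReal_mul,
    Complex.add_re, ← heisGroundCorr_of_neZero, ← heisGroundCorr_of_neZero,
    heisGroundCorr_symm α L n y x]
  ring

/-- **The ground energy of the antiferromagnet, edge by edge**: `E₀ = Re ω(H) = 3 Σ_{e ∈ E} G¹(e)`
(isotropy (I)). [Kennedy–Lieb–Shastry 1988, p. 1021 (`-e₀` is the ground-state energy per
site; the factor `1/3`)] [folklore] -/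
theorem groundEnergy_heisenbergTorus_eq (L : ℕ) [NeZero L] (n : ℕ) :
    (heisenbergTorus d L n 1).groundEnergy =
      3 * ∑ e ∈ (torusGraph d L).edgeFinset, Sym2.lift
        ⟨fun x y => heisGroundCorr 0 L n x y, fun x y => heisGroundCorr_symm 0 L n x y⟩ e := by
  have hHerm := heisenbergTorus_isHermitian d L n 1
  set ω := (heisenbergTorus d L n 1).groundStateFunctional with hω
  have h := congrArg Complex.re (groundStateFunctional_hamiltonian hHerm)
  rw [Complex.ofReal_re] at h
  have hsum : heisenbergTorus d L n 1 = ∑ e ∈ (torusGraph d L).edgeFinset, spinDotSym n e := by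
    rw [show heisenbergTorus d L n 1 = ((1 : ℝ) : ℂ) • ∑ e ∈ (torusGraph d L).edgeFinset,
      spinDotSym n e from rfl, Complex.ofReal_one, one_smul]
  rw [← h, ← hω, congrArg ω hsum, map_sum, Complex.re_sum, mul_sum]
  refine sum_congr rfl fun e _ => ?_
  induction e using Sym2.ind with
  | h x y =>
    rw [spinDotSym_mk, Sym2.lift_mk, spinDot, map_sum, Complex.re_sum, Fin.sum_univ_three,
      re_groundStateFunctional_heis_spinBond, re_groundStateFunctional_heis_spinBond,
      re_groundStateFunctional_heis_spinBond, heisGroundCorr_one_eq_zero,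
      heisGroundCorr_two_eq_zero]
    ring

/-- **(N) The Néel variational bound** `ε ≤ -S²/3` on even tori of side `2k ≥ 4`
(`e₀ ≥ d S²`): the Néel basis state (spin up on the even sublattice, down on the odd one) has
energy `-S² |E|`, so `E₀ = 3 Σ_E G¹ ≤ -S²|E|` by the variational principle, and the pair average
`ε` is the edge average of `G¹` (`d L^d = |E|` for `L ≥ 3`).
[Kennedy–Lieb–Shastry 1988, p. 1022 ("taking the Néel state as a variational state");
Dyson–Lieb–Simon 1978, App. C] [cite: KLS1988JSP, p. 1022] -/
theorem heisBondCorr_le (hd : 1 ≤ d) (n k : ℕ) (hk : 2 ≤ k) :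
    heisBondCorr (d := d) 0 (2 * k) n ≤ -(((n : ℝ) / 2) ^ 2 / 3) := by
  haveI : NeZero (2 * k) := ⟨by omega⟩
  have hL : 2 ≤ 2 * k := by omega
  set L := 2 * k with hLdef
  set E := (torusGraph d L).edgeFinset with hE
  set g : Sym2 (TorusSite d L) → ℝ :=
    Sym2.lift ⟨fun x y => heisGroundCorr 0 L n x y, fun x y => heisGroundCorr_symm 0 L n x y⟩
    with hg
  set H := heisenbergTorus d L n 1 with hH
  have hHerm : H.IsHermitian := heisenbergTorus_isHermitian d L n 1
  -- (1) the ground energy is `3 Σ_E g`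
  have h1 : H.groundEnergy = 3 * ∑ e ∈ E, g e := groundEnergy_heisenbergTorus_eq L n
  -- (2) the Néel configuration and its energy
  set ε : TorusSite d L → ZMod 2 := fun x =>
    ∑ j, ZMod.castHom (dvd_mul_right 2 k) (ZMod 2) (x j) with hε
  set σN : TensorIndex (TorusSite d L) (n + 1) := fun x => if ε x = 0 then 0 else Fin.last n
    with hσN
  have h01 : ∀ t : ZMod 2, t = 0 ∨ t = 1 := by decide
  have hedge : ∀ e ∈ E, ∀ x y, e = s(x, y) →
      x ≠ y ∧ (σN x = 0 ∧ σN y = Fin.last n ∨ σN x = Fin.last n ∧ σN y = 0) := by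
    intro e he x y hexy
    subst hexy
    have hne : x ≠ y := by
      intro h
      exact SimpleGraph.not_isDiag_of_mem_edgeSet _ (SimpleGraph.mem_edgeFinset.1 he)
        (by rw [h]; exact Sym2.mk_isDiag_iff.2 rfl)
    refine ⟨hne, ?_⟩
    rw [hE, SimpleGraph.mem_edgeFinset, SimpleGraph.mem_edgeSet, torusGraph_adj_iff] at he
    have key : ∀ x' : TorusSite d L, ∀ i,
        (σN x' = 0 ∧ σN (x' + Pi.single i 1) = Fin.last n ∨
          σN x' = Fin.last n ∧ σN (x' + Pi.single i 1) = 0) := by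
      intro x' i
      have hpar : ε (x' + Pi.single i 1) = ε x' + 1 := torusParity_add_single k x' i
      simp only [hσN, hpar]
      rcases h01 (ε x') with h0 | h1'
      · left
        rw [if_pos h0, if_neg (by rw [h0]; decide)]
        exact ⟨rfl, rfl⟩
      · right
        rw [if_neg (by rw [h1']; decide), if_pos (by rw [h1']; decide)]
        exact ⟨rfl, rfl⟩
    obtain ⟨-, ⟨i, rfl⟩ | ⟨i, rfl⟩⟩ := he
    · exact key x i
    · rcases key y i with ⟨ha, hb⟩ | ⟨ha, hb⟩
      · exact Or.inr ⟨hb, ha⟩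
      · exact Or.inl ⟨hb, ha⟩
  have h2 : H σN σN = -((((n : ℂ) / 2) ^ 2) * (E.card : ℂ)) := by
    have hsum : H = ∑ e ∈ E, spinDotSym n e := by
      rw [hH, show heisenbergTorus d L n 1 = ((1 : ℝ) : ℂ) • ∑ e ∈ E, spinDotSym n e from rfl,
        Complex.ofReal_one, one_smul]
    have hrhs : -((((n : ℂ) / 2) ^ 2) * (E.card : ℂ)) = ∑ _e ∈ E, -(((n : ℂ) / 2) ^ 2) := by
      rw [sum_const, nsmul_eq_mul]
      ring
    rw [hsum, Matrix.sum_apply, hrhs]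
    refine sum_congr rfl fun e he => ?_
    induction e using Sym2.ind with
    | h x y =>
      obtain ⟨hxy, hσ⟩ := hedge _ he x y rfl
      rw [spinDotSym_mk, spinDot_apply_neel n hxy σN hσ]
  -- (3) the variational principle
  set v : TensorIndex (TorusSite d L) (n + 1) → ℂ := Pi.single σN 1 with hv
  have hstar : star v = v := by rw [hv, ← Pi.single_star, star_one]
  have hψ : star v ⬝ᵥ v = 1 := by
    rw [hstar, hv, single_dotProduct, Pi.single_eq_same, one_mul]
  have h3 := groundEnergy_le_rayleigh_holds hHerm v hψ
  rw [h1, hstar, hv, single_dotProduct, one_mul, mulVec_single_one, Matrix.col_apply, h2,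
    Complex.neg_re, show (((n : ℂ) / 2) ^ 2 * (E.card : ℂ)) =
      ((((n : ℝ) / 2) ^ 2 * (E.card : ℝ) : ℝ) : ℂ) by push_cast; ring, Complex.ofReal_re] at h3
  -- `Σ_E g ≤ -(S²/3) |E|`
  have h4 : ∑ e ∈ E, g e ≤ -(((n : ℝ) / 2) ^ 2 / 3) * (E.card : ℝ) := by linarith
  -- (4) pairs versus edges
  have h5 := sum_pairs_eq_sum_edgeFinset L hL g
  have h6 := sum_pairs_eq_sum_edgeFinset (d := d) L hL (fun _ => (1 : ℝ))
  simp only [sum_const, card_univ, nsmul_eq_mul, mul_one, Fintype.card_fin] at h6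
  have hL2 : ¬ (L = 2) := by omega
  rw [if_neg hL2, one_mul] at h5 h6
  rw [heisBondCorr_of_neZero]
  have hcard : (Fintype.card (TorusSite d L) : ℝ) = (L : ℝ) ^ d := by
    rw [Fintype.card_pi, prod_const, ZMod.card, card_univ, Fintype.card_fin]
    push_cast
    ring
  have hg' : ∀ (x : TorusSite d L) (i : Fin d),
      heisGroundCorr 0 L n x (x + Pi.single i 1) = g s(x, x + Pi.single i 1) := fun x i => rfl
  simp_rw [hg']
  rw [h5]
  have hpos : (0 : ℝ) < (d : ℝ) * (L : ℝ) ^ d := by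
    have : (0 : ℝ) < L := by exact_mod_cast (show 0 < L by omega)
    have : (0 : ℝ) < d := by exact_mod_cast (show 0 < d by omega)
    positivity
  rw [div_le_iff₀ hpos]
  have h7 : (d : ℝ) * (L : ℝ) ^ d = (E.card : ℝ) := by rw [← hcard, mul_comm, h6]
  rw [h7]
  exact h4

end NeelBound

end Literature.MathematicalPhysics.QuantumLattice
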